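/-
Origin: expansion seat `planner-pub-hodgecm-landherr-g9-0`, handover #1 2026-08-18T07:56:36Z (`HOME/pub-hodgecm-landherr-g9/lean/LandherrG9/HermSpace3Isotropy.lean`, md5 608873b6, 316 lines);
landed by the gen-7 packager in gate run 26 as `HodgeCM/Proofs/LandherrIsotropy.lean` (verbatim).
-/
/-
Copyright: pub-hodgecm formalisation cell (harness21, 2026). New file (not vendored).
Origin: HOME/pub-hodgecm-landherr-g9/lean/LandherrG9/HermSpace3Isotropy.lean — session
planner-pub-hodgecm-landherr-g9-0 (unit pub-hodgecm-landherr-g9, EXPANSION part (c) `Lemma33bLandherr`, gen 9).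
Intended final place: `HodgeCM/Proofs/LandherrIsotropy.lean` (additive leaf; imports only the landed
`HodgeCM.Proofs.LandherrHermSpace3` (run 25); nothing in the package depends on it).
-/
import Summits.HodgeConjecture.HodgeCM.Proofs.LandherrHermSpace3

set_option autoImplicit false

/-!
# Isotropy of PerL's hermitian 3-spaces: `(V₃, h)` is anisotropic iff `L` has a second infinite place

For `V : HodgeCM.HermSpace3 L ι₁` (`HodgeCM/CM/Basic.lean`: a hermitian Gram matrix `Hm ∈ M₃(L)` over the CM field
`L`, of signature `(2,1)` at the place of `ι₁` and positive definite at every complex embedding off that place) write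
`⟪u, v⟫ = hermForm σ Hm u v = Σ σ(uᵢ) Hmᵢⱼ vⱼ` (`σ = conjRingHomK L`; the vendored `hermForm` of
`HodgeCM/Vendored/Hermitian.lean`).  `V.IsIsotropic` says that `h` has an isotropic vector: `⟪x, x⟫ = 0` for some
`x ≠ 0` in `L³`.  This file proves the dichotomy behind "the Picard modular surfaces of this programme are COMPACT"
(`[G_U] = U(V)(L₀)\U(V)(𝔸_{L₀})` compact, `HodgeCM/Automorphic/ModelCarrierCompact.lean`; PerL v5 ll. 384–385 for
`[U(W)]`; [BMM] §6.1 "anisotropic Hermitian vector space", `Literature/ThetaLiftExhaustion.lean`) as pure algebra: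

* §0 `LandherrIsotropy.eq_zero_of_posDef_map` (any rank): a `σ`-hermitian Gram matrix over `L` that is positive
  definite at ONE complex embedding `τ` has no isotropic vector (apply `τ`: `τ⟪x,x⟫ = (τx)ᴴ · τ(Hm) · (τx) > 0`);
  `hermForm_mulVec_mulVec`: `⟪g u, g v⟫_H = ⟪u, v⟫_{ᵗ(σg) H g}` (isotropy is an isometry invariant,
  `HermSpace3.isIsotropic_of_isometric`);
* §1 `HermSpace3.not_isIsotropic_of_ne`: if `L` has a complex embedding `τ` off the place of `ι₁` — equivalently
  `[L:ℚ] > 2` — then every `(V₃,h)` of PerL's signature is ANISOTROPIC (it is definite at `τ`);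
* §2 `HermSpace3.isIsotropic_of_forall_mk_eq`: if the place of `ι₁` is the ONLY infinite place of `L` (`L` imaginary
  quadratic) then every `(V₃,h)` is ISOTROPIC — by Landherr's theorem for `(V₃,h)` (`HermSpace3.isometric_of_det_eq`,
  `Proofs/LandherrHermSpace3.lean`, gen 8) it is isometric to `⟨1, -1, -det h⟩` (a `HermSpace3` in this case:
  `exists_Hm_eq_hyperbolic`), which has the isotropic vector `(1, 1, 0)`;
* §3 the dichotomy collected: **`HermSpace3.isIsotropic_iff`** (`V.IsIsotropic ↔ ∀ τ, mk τ = mk ι₁`),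
  `isIsotropic_iff_card_infinitePlace_eq_one`, **`isIsotropic_iff_finrank_eq_two`** (`↔ [L:ℚ] = 2`), and the Witt
  form `isIsotropic_iff_isometric_hyperbolic` (`↔ h ≅ ⟨1, -1, -det h⟩`, hyperbolic plane `⊥` a line).

So in PerL's regime (`[L:ℚ] ≥ 4`) `U(V₃,h)` is an anisotropic unitary group, while over an imaginary quadratic
field the same signature condition gives the ISOTROPIC spaces of Rogawski's non-compact Picard modular surfaces
(`Literature/Rogawski.lean`) — the line drawn in `Literature/ThetaLiftExhaustion.lean` ("NOT covered by [BMM]: the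
non-compact case `d = 1`").  Pure proof over landed modules: nothing is cited or posited; closures are the standard trio.
-/

noncomputable section

open scoped Matrix ComplexOrder
open NumberField
open Literature.AlgebraicGeometry.ShimuraVarieties

namespace HodgeCM

/-! ## §0. Hermitian Gram matrices over a CM field: transport, and definiteness at one embedding -/

namespace LandherrIsotropy

variable (L : CMField) {m : Type} [Fintype m]

/-- Applying `σ` to the coordinates of `g u` gives `σ(g) (σ u)`. -/
theorem comp_mulVec (σ : L →+* L) (g : Matrix m m L) (u : m → L) :
    (σ ∘ (g *ᵥ u)) = g.map σ *ᵥ (σ ∘ u) :=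
  funext fun i => RingHom.map_mulVec σ g u i

/-- **Transport of the form under a change of coordinates**: `⟪g u, g v⟫_H = ⟪u, v⟫_{ᵗ(σg) · H · g}`. -/
theorem hermForm_mulVec_mulVec (σ : L →+* L) (H g : Matrix m m L) (u v : m → L) :
    hermForm σ H (g *ᵥ u) (g *ᵥ v) = hermForm σ ((g.map σ)ᵀ * H * g) u v := by
  unfold hermForm
  rw [comp_mulVec, ← Matrix.vecMul_transpose, ← Matrix.dotProduct_mulVec, Matrix.mulVec_mulVec,
    Matrix.mulVec_mulVec, Matrix.mul_assoc]

/-- An invertible change of coordinates kills no non-zero vector. -/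
theorem mulVec_ne_zero [DecidableEq m] (g : GL m L) {y : m → L} (hy : y ≠ 0) : (g : Matrix m m L) *ᵥ y ≠ 0 := by
  intro h
  apply hy
  calc y = ((g⁻¹ : GL m L) : Matrix m m L) *ᵥ ((g : Matrix m m L) *ᵥ y) := by
          rw [Matrix.mulVec_mulVec, ← Units.val_mul, inv_mul_cancel, Units.val_one, Matrix.one_mulVec]
    _ = 0 := by rw [h, Matrix.mulVec_zero]

/-- **Definite somewhere ⇒ anisotropic.**  If the Gram matrix `H` over the CM field `L` is positive definite at
some complex embedding `τ` (as the complex hermitian matrix `τ(H)`), then `⟪x, x⟫_H = 0` forces `x = 0`: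
apply `τ` and use `τ⟪x, x⟫_H = (τx)ᴴ · τ(H) · (τx)` (`map_hermForm`). -/
theorem eq_zero_of_posDef_map (H : Matrix m m L) (τ : L →+* ℂ) (hH : (H.map τ).PosDef) {x : m → L}
    (hx : hermForm (conjRingHomK L) H x x = 0) : x = 0 := by
  by_contra hne
  have hne' : (τ ∘ x) ≠ 0 := by
    intro h0
    apply hne
    funext i
    exact (map_eq_zero τ).mp (congrFun h0 i)
  have hpos := hH.dotProduct_mulVec_pos hne'
  have hmap := map_hermForm τ (embedding_conjRingHomK L τ) H x x
  rw [hx, map_zero, hermForm_starRingEnd] at hmap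
  rw [← hmap] at hpos
  exact lt_irrefl _ hpos

/-- The same, as the absence of isotropic vectors. -/
theorem not_exists_isotropic_of_posDef_map (H : Matrix m m L) (τ : L →+* ℂ) (hH : (H.map τ).PosDef) :
    ¬ ∃ x : m → L, x ≠ 0 ∧ hermForm (conjRingHomK L) H x x = 0 :=
  fun ⟨_, hx, h0⟩ => hx (eq_zero_of_posDef_map L H τ hH h0)

end LandherrIsotropy

/-! ## §1. `(V₃, h)`: isotropy, its isometry invariance, and anisotropy off the one-place case -/

namespace HermSpace3

variable {L : CMField} {ι₁ : L →+* ℂ}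

/-- `(V₃, h)` **is isotropic**: `h(x, x) = 0` for some non-zero `x ∈ L³`. -/
def IsIsotropic (V : HermSpace3 L ι₁) : Prop :=
  ∃ x : Fin 3 → L, x ≠ 0 ∧ hermForm (conjRingHomK L) V.Hm x x = 0

/-- Isotropy is transported along an isometry `ᵗ(σg) · Hm · g = Hm'`: an isotropic vector `y` of `h'` gives the
isotropic vector `g y` of `h`. -/
theorem isIsotropic_of_isometric (V V' : HermSpace3 L ι₁) (g : GL (Fin 3) L)
    (hg : ((g : Matrix (Fin 3) (Fin 3) L).transpose.map (conjRingHomK L)) * V.Hm *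
        (g : Matrix (Fin 3) (Fin 3) L) = V'.Hm) (h : V'.IsIsotropic) : V.IsIsotropic := by
  obtain ⟨y, hy, h0⟩ := h
  refine ⟨(g : Matrix (Fin 3) (Fin 3) L) *ᵥ y, LandherrIsotropy.mulVec_ne_zero L g hy, ?_⟩
  rw [LandherrIsotropy.hermForm_mulVec_mulVec, ← Matrix.transpose_map, hg, h0]

/-- Isometric spaces are isotropic together. -/
theorem isIsotropic_iff_of_isometric (V V' : HermSpace3 L ι₁) (g : GL (Fin 3) L)
    (hg : ((g : Matrix (Fin 3) (Fin 3) L).transpose.map (conjRingHomK L)) * V.Hm *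
        (g : Matrix (Fin 3) (Fin 3) L) = V'.Hm) : V.IsIsotropic ↔ V'.IsIsotropic := by
  refine ⟨fun h => ?_, isIsotropic_of_isometric V V' g hg⟩
  -- the inverse isometry `g⁻¹ : (V₃', h') ≅ (V₃, h)`
  refine isIsotropic_of_isometric V' V g⁻¹ ?_ h
  rw [← hg]
  calc ((((g⁻¹ : GL (Fin 3) L) : Matrix (Fin 3) (Fin 3) L)).transpose.map (conjRingHomK L)) *
        ((((g : Matrix (Fin 3) (Fin 3) L)).transpose.map (conjRingHomK L)) * V.Hm * (g : Matrix (Fin 3) (Fin 3) L)) *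
        ((g⁻¹ : GL (Fin 3) L) : Matrix (Fin 3) (Fin 3) L)
      = (((g : Matrix (Fin 3) (Fin 3) L) * ((g⁻¹ : GL (Fin 3) L) : Matrix (Fin 3) (Fin 3) L)).transpose.map
          (conjRingHomK L)) * V.Hm * ((g : Matrix (Fin 3) (Fin 3) L) * ((g⁻¹ : GL (Fin 3) L) : Matrix _ _ L)) := by
        rw [Matrix.transpose_mul, Matrix.map_mul]; simp only [Matrix.mul_assoc]
    _ = V.Hm := by
        rw [← Units.val_mul, mul_inv_cancel, Units.val_one, Matrix.transpose_one,
          Matrix.map_one _ (map_zero _) (map_one _), Matrix.one_mul, Matrix.mul_one]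

/-- **Anisotropy off the one-place case.**  If `L` has a complex embedding `τ` off the place of `ι₁`, then
`(V₃, h)` is anisotropic: `h` is positive definite at `τ`. -/
theorem not_isIsotropic_of_ne (V : HermSpace3 L ι₁) (τ : L →+* ℂ)
    (hτ : InfinitePlace.mk τ ≠ InfinitePlace.mk ι₁) : ¬ V.IsIsotropic :=
  LandherrIsotropy.not_exists_isotropic_of_posDef_map L V.Hm τ (V.posDef_of_ne τ hτ)

/-- Equivalently: an isotropic `(V₃, h)` forces the place of `ι₁` to be the only infinite place of `L`. -/
theorem forall_mk_eq_of_isIsotropic (V : HermSpace3 L ι₁) (h : V.IsIsotropic) (τ : L →+* ℂ) :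
    InfinitePlace.mk τ = InfinitePlace.mk ι₁ := by
  by_contra hτ
  exact not_isIsotropic_of_ne V τ hτ h

/-! ## §2. The one-place case: `h ≅ ⟨1, -1, -det h⟩` is isotropic -/

/-- `det diag(1, -1, c) = -c`. -/
theorem det_diagonal_one_neg_one (c : L) : (Matrix.diagonal ![(1 : L), -1, c]).det = -c := by
  rw [Matrix.det_diagonal, Fin.prod_univ_three]
  simp

/-- `(1, 1, 0)` is an isotropic vector of `diag(1, -1, c)`: `1 · 1 + (-1) · 1 + c · 0 = 0`. -/
theorem hermForm_diagonal_hyperbolic (c : L) :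
    hermForm (conjRingHomK L) (Matrix.diagonal ![(1 : L), -1, c]) ![1, 1, 0] ![1, 1, 0] = 0 := by
  simp [hermForm, Matrix.mulVec_diagonal, dotProduct, Fin.sum_univ_three]

/-- (Ported verbatim from the HodgeCMPerL package; no docstring in the source.) -/
theorem vec_one_one_zero_ne_zero : (![1, 1, 0] : Fin 3 → L) ≠ 0 := by
  intro h
  have := congrFun h 0
  simp at this

/-- **The space `⟨1, -1, c⟩` in the one-place case.**  If the place of `ι₁` is the only infinite place of `L` and
`c ∈ L₀` is positive at `ι₁`, the diagonal form `⟨1, -1, c⟩` is a `HermSpace3 L ι₁`: signature `(2,1)` at `ι₁`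
(Sylvester matrix `T = e₁₁ + e₃₂ + e₂₃/√(ι₁ c)`, `Tᴴ · diag(1,-1,ι₁ c) · T = diag(1,1,-1)`), and the positive
definiteness condition off the place of `ι₁` is vacuous. -/
theorem exists_Hm_eq_hyperbolic (h1 : ∀ τ : L →+* ℂ, InfinitePlace.mk τ = InfinitePlace.mk ι₁) {c : L}
    (hc : conjRingHomK L c = c) (hpos : 0 < (ι₁ c).re) :
    ∃ V : HermSpace3 L ι₁, V.Hm = Matrix.diagonal ![1, -1, c] := by
  set r : ℝ := (ι₁ c).re with hrdef
  have hr : ι₁ c = (r : ℂ) := Lemma33bLandherrProof.embedding_eq_re L hc ι₁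
  refine ⟨{ Hm := Matrix.diagonal ![1, -1, c], isHermitian := ?_, signature_ι₁ := ?_, posDef_of_ne := ?_ }, rfl⟩
  · intro i j
    fin_cases i <;> fin_cases j <;> simp [Matrix.diagonal, hc]
  · have hmap : (Matrix.diagonal ![(1 : L), -1, c]).map ι₁ = Matrix.diagonal ![(1 : ℂ), -1, (r : ℂ)] := by
      rw [Matrix.diagonal_map (map_zero ι₁)]
      congr 1; funext i; fin_cases i <;> simp [hr]
    set k : ℝ := (Real.sqrt r)⁻¹ with hk
    have hsq : Real.sqrt r ^ 2 = r := Real.sq_sqrt hpos.le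
    have hsqrt_pos : 0 < Real.sqrt r := Real.sqrt_pos.mpr hpos
    have hk0 : k ≠ 0 := inv_ne_zero hsqrt_pos.ne'
    have hkrk : (k : ℂ) * (r : ℂ) * (k : ℂ) = 1 := by
      have : k * r * k = 1 := by
        rw [hk]; field_simp; nlinarith [hsq]
      exact_mod_cast this
    -- `T = e₁₁ + e₂₃·k + e₃₂`: columns `e₁`, `k e₃`, `e₂`
    let T : Matrix (Fin 3) (Fin 3) ℂ := !![1, 0, 0; 0, 0, 1; 0, (k : ℂ), 0]
    have hdet : T.det ≠ 0 := by
      rw [Matrix.det_fin_three]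
      simp [T, hk0]
    refine ⟨Matrix.GeneralLinearGroup.mkOfDetNeZero T hdet, ?_⟩
    rw [Matrix.GeneralLinearGroup.val_mkOfDetNeZero, hmap]
    unfold signatureMatrix
    ext i j
    fin_cases i <;> fin_cases j <;>
      simp [T, Matrix.mul_apply, Matrix.conjTranspose_apply, Fin.sum_univ_three, Matrix.diagonal, Fin.last,
        Fin.ext_iff]
    · -- entry `(1,1)`: `k̄ · r · k = 1`
      simpa [mul_comm, mul_assoc] using hkrk
  · intro τ hτ
    exact (hτ (h1 τ)).elim

/-- **Isotropy in the one-place case** (Landherr).  If the place of `ι₁` is the only infinite place of `L`, every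
`(V₃, h)` is isotropic: by `HermSpace3.isometric_of_det_eq` it is isometric to `⟨1, -1, -det h⟩`, which has the
isotropic vector `(1, 1, 0)`. -/
theorem isIsotropic_of_forall_mk_eq (V : HermSpace3 L ι₁)
    (h1 : ∀ τ : L →+* ℂ, InfinitePlace.mk τ = InfinitePlace.mk ι₁) : V.IsIsotropic := by
  have hc : conjRingHomK L (-V.Hm.det) = -V.Hm.det := by rw [map_neg, V.det_isReal]
  have hpos : 0 < (ι₁ (-V.Hm.det)).re := by
    rw [map_neg, Complex.neg_re]
    exact neg_pos.mpr V.det_re_neg_ι₁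
  obtain ⟨V₀, hV₀⟩ := exists_Hm_eq_hyperbolic h1 hc hpos
  have hdet : V.Hm.det = V₀.Hm.det := by rw [hV₀, det_diagonal_one_neg_one, neg_neg]
  obtain ⟨g, hg⟩ := isometric_of_det_eq V V₀ hdet
  refine isIsotropic_of_isometric V V₀ g hg ⟨![1, 1, 0], vec_one_one_zero_ne_zero, ?_⟩
  rw [hV₀]
  exact hermForm_diagonal_hyperbolic _

/-! ## §3. The dichotomy -/

/-- **`(V₃, h)` is isotropic iff the place of `ι₁` is the only infinite place of `L`.**  (⇒: positive definiteness
at a second place; ⇐: Landherr's classification, §2.) -/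
theorem isIsotropic_iff (V : HermSpace3 L ι₁) :
    V.IsIsotropic ↔ ∀ τ : L →+* ℂ, InfinitePlace.mk τ = InfinitePlace.mk ι₁ :=
  ⟨forall_mk_eq_of_isIsotropic V, isIsotropic_of_forall_mk_eq V⟩

/-- "The place of `ι₁` is the only infinite place" iff `L` has exactly one infinite place. -/
theorem forall_mk_eq_iff_card_eq_one (ι₁ : L →+* ℂ) :
    (∀ τ : L →+* ℂ, InfinitePlace.mk τ = InfinitePlace.mk ι₁) ↔ Fintype.card (InfinitePlace L) = 1 := by
  rw [Fintype.card_eq_one_iff]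
  constructor
  · intro h
    exact ⟨InfinitePlace.mk ι₁, fun w => by rw [← InfinitePlace.mk_embedding w]; exact h _⟩
  · rintro ⟨w, hw⟩ τ
    rw [hw (InfinitePlace.mk τ), hw (InfinitePlace.mk ι₁)]

/-- For the CM (hence totally complex) field `L`: `[L:ℚ] = 2 · #{infinite places}`. -/
theorem finrank_eq_two_mul_card_infinitePlace (L : CMField) :
    Module.finrank ℚ L = 2 * Fintype.card (InfinitePlace L) := by
  rw [IsTotallyComplex.finrank, InfinitePlace.card_eq_nrRealPlaces_add_nrComplexPlaces,
    IsTotallyComplex.nrRealPlaces_eq_zero, zero_add]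

/-- **`(V₃, h)` is isotropic iff `L` has exactly one infinite place.** -/
theorem isIsotropic_iff_card_infinitePlace_eq_one (V : HermSpace3 L ι₁) :
    V.IsIsotropic ↔ Fintype.card (InfinitePlace L) = 1 := by
  rw [isIsotropic_iff, forall_mk_eq_iff_card_eq_one]

/-- **`(V₃, h)` is isotropic iff `[L:ℚ] = 2`**, i.e. iff the CM field `L` is imaginary quadratic. -/
theorem isIsotropic_iff_finrank_eq_two (V : HermSpace3 L ι₁) :
    V.IsIsotropic ↔ Module.finrank ℚ L = 2 := by
  rw [isIsotropic_iff_card_infinitePlace_eq_one, finrank_eq_two_mul_card_infinitePlace L]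
  omega

/-- **PerL's regime**: over a CM field of degree `[L:ℚ] ≠ 2` (PerL: `[L:ℚ] ≥ 4`) every `(V₃, h)` of the wall's
signatures is ANISOTROPIC. -/
theorem not_isIsotropic_of_finrank_ne_two (V : HermSpace3 L ι₁) (hL : Module.finrank ℚ L ≠ 2) :
    ¬ V.IsIsotropic :=
  fun h => hL ((isIsotropic_iff_finrank_eq_two V).mp h)

/-- `g = [L:ℚ]/2` (`CMField.halfDegree`, `CM/Basic.lean`) is the number of infinite places of the CM field `L`. -/
theorem halfDegree_eq_card_infinitePlace (L : CMField) : L.halfDegree = Fintype.card (InfinitePlace L) := by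
  rw [CMField.halfDegree, finrank_eq_two_mul_card_infinitePlace L, Nat.mul_div_cancel_left _ two_pos]

/-- **`(V₃, h)` is isotropic iff `g = 1`.** -/
theorem isIsotropic_iff_halfDegree_eq_one (V : HermSpace3 L ι₁) : V.IsIsotropic ↔ L.halfDegree = 1 := by
  rw [isIsotropic_iff_card_infinitePlace_eq_one, halfDegree_eq_card_infinitePlace L]

/-- PerL's regime in the package's own shape — Rogawski §14.6's standing hypothesis `2 ≤ M.halfDegree`
(`Literature/RogawskiMultiplicityOne.lean`, "`G' ≇ G`") — gives `[L:ℚ] ≠ 2` … -/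
theorem _root_.HodgeCM.CMField.finrank_ne_two_of_two_le_halfDegree {L : CMField} (hg : 2 ≤ L.halfDegree) :
    Module.finrank ℚ L ≠ 2 := by
  unfold CMField.halfDegree at hg
  omega

/-- … hence, under `2 ≤ g`, every `(V₃, h)` is anisotropic. -/
theorem not_isIsotropic_of_two_le_halfDegree (V : HermSpace3 L ι₁) (hg : 2 ≤ L.halfDegree) : ¬ V.IsIsotropic := by
  rw [isIsotropic_iff_halfDegree_eq_one]
  omega

/-- Spelled out: `h(x, x) = 0 ⇒ x = 0` on `L³` as soon as `[L:ℚ] ≠ 2`. -/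
theorem eq_zero_of_hermForm_eq_zero (V : HermSpace3 L ι₁) (hL : Module.finrank ℚ L ≠ 2) {x : Fin 3 → L}
    (hx : hermForm (conjRingHomK L) V.Hm x x = 0) : x = 0 := by
  by_contra hne
  exact not_isIsotropic_of_finrank_ne_two V hL ⟨x, hne, hx⟩

/-- **Witt form of the dichotomy.**  `(V₃, h)` is isotropic iff it is isometric to `⟨1, -1, -det h⟩` (a hyperbolic
plane `⟨1, -1⟩` orthogonally summed with the line `⟨-det h⟩`). -/
theorem isIsotropic_iff_isometric_hyperbolic (V : HermSpace3 L ι₁) :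
    V.IsIsotropic ↔ ∃ g : GL (Fin 3) L, ((g : Matrix (Fin 3) (Fin 3) L).transpose.map (conjRingHomK L)) * V.Hm *
        (g : Matrix (Fin 3) (Fin 3) L) = Matrix.diagonal ![1, -1, -V.Hm.det] := by
  constructor
  · intro h
    have h1 := forall_mk_eq_of_isIsotropic V h
    have hc : conjRingHomK L (-V.Hm.det) = -V.Hm.det := by rw [map_neg, V.det_isReal]
    have hpos : 0 < (ι₁ (-V.Hm.det)).re := by
      rw [map_neg, Complex.neg_re]
      exact neg_pos.mpr V.det_re_neg_ι₁
    obtain ⟨V₀, hV₀⟩ := exists_Hm_eq_hyperbolic h1 hc hpos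
    have hdet : V.Hm.det = V₀.Hm.det := by rw [hV₀, det_diagonal_one_neg_one, neg_neg]
    obtain ⟨g, hg⟩ := isometric_of_det_eq V V₀ hdet
    exact ⟨g, by rw [hg, hV₀]⟩
  · rintro ⟨g, hg⟩
    refine ⟨(g : Matrix (Fin 3) (Fin 3) L) *ᵥ ![1, 1, 0], LandherrIsotropy.mulVec_ne_zero L g vec_one_one_zero_ne_zero,
      ?_⟩
    rw [LandherrIsotropy.hermForm_mulVec_mulVec, ← Matrix.transpose_map, hg]
    exact hermForm_diagonal_hyperbolic _

end HermSpace3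

end HodgeCM

end
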